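import Summits.HodgeConjecture.HodgeConjecture.Theorems.F0P3cStCharTSWeylCartanRadial     -- ★ p851692 «ELL-TOR★» (this seat): `centralizer_eq_of_mem_centralizer_of_isRegularElt`, `isRegularElt_conj_val_iff`, `measurableSet_cartanSet`
import HarnessLib

/-!
# F0 · P3c · line LH6 «StCharTS» — «ELL-TOR★» (E2a) «CARTAN-SET PARTITION»: the `T`-regular sets `G_T = ⋃ₓ x T^{reg} x⁻¹` of a system of representatives of the conjugacy
# classes of Cartan subgroups PARTITION the regular set of `U(Φ₃)(L⁺_v)` — the index set of the Weyl integration formula (Rogawski 1990 §12.5 p. 182 «the sum is over a set of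
# representatives for the conjugacy classes of Cartan subgroups of `G`»; Harish-Chandra 1970 Lemma 42)

Cell `pub/hodgecm-mathlib`, crux H413 = `stmt-HodgeConjecture-24833` (lane `--supports`, helper); seat F0P3a-p05 (g22); road «ELL-TOR★» (NAMING 2026-09-02T14:19:42Z, «=» LH6-p03
(g5) 14:22:45Z).  THEOREMS ONLY; sorry-free; no definition ∕ instance ∕ notation ∕ named fact; ★-only imports; axioms TRIO.

THE POINT.  The Weyl integration formula (★ `Ch12Sec5.WeylIntegrationFormula`, the RUNG0 named-block antecedent `hWIF`) is `∫_G = Σ_{T ∈ cartanAll} |Ω(T,G)|⁻¹ ∫_T …`; in house it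
is the SUM over representatives `T` of the per-Cartan radial formulas (★ p849733 at `M`, ★ p851692 at every `Z(γ₀)`) with their Jacobian sockets (★ p851645, «JAC-CARTAN BY SHAPE»),
glued along the decomposition `G^{reg} = ⨆_{T ∈ S} G_T`.  This file is that decomposition, for a family `S` of Cartan subgroups `T = Z(γ₀)` in the tree's currency (★ S9a ∕ ★
`F0P3cStCharTSCartanReps.exists_normalised_cartan_family`: conjugacy as `∀ g, g ∈ T′ ↔ x⁻¹ g x ∈ T`, covering as «every `Z(γ)`, `γ` regular, is conjugate to a member»):
* §1 the set `G_T = {g t g⁻¹ | t ∈ T regular}` (written inline, as in ★ p849733 ∕ ★ p851692): regular elements, conjugation-invariant, monotone in nothing but DEPENDING ONLY ON THE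
  CONJUGACY CLASS of `T` (`cartanSet_eq_of_forall_mem_iff`);
* §2 for Cartan subgroups `T = Z(γ₀)`: every regular `γ` lies in `G_{Z(γ)}` and in `G_T` for any representative `T` of the class of `Z(γ)` (`mem_cartanSet_of_forall_mem_iff`); the
  centraliser of `x t x⁻¹` is `x Z(t) x⁻¹`; **`exists_forall_mem_iff_of_mem_cartanSet_of_mem_cartanSet`** — if `G_T ∩ G_{T′} ≠ ∅` then `T′` is conjugate to `T` (both are
  `Z(·)` of a common regular element up to conjugation, ★ p851692 `centralizer_eq_of_mem_centralizer_of_isRegularElt`); hence **`disjoint_cartanSet_of_not_conj`**;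
* §3 for a finite family `S` of Cartan subgroups meeting every conjugacy class: **`biUnion_cartanSet_eq_setOf_isRegularElt`** (`⋃_{T ∈ S} G_T = G^{reg}`), and for `S` pairwise
  non-conjugate the MEASURE ∕ INTEGRAL form **`lintegral_setOf_isRegularElt_eq_sum_cartanSet`**: `∫⁻_{G^{reg}} f dν = Σ_{T ∈ S} ∫⁻_{G_T} f dν` (`G_T` Borel: ★ p851692
  `measurableSet_cartanSet`), and, GIVEN the singular set is `ν`-null (hypothesis `hsing`, [HarishChandra1970 L. 42]: the non-regular elements form a null set),
  **`lintegral_eq_sum_cartanSet_of_null`**: `∫⁻_G f dν = Σ_{T ∈ S} ∫⁻_{G_T} f dν` — the outer sum of WIF.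
HONEST LABEL: count-neutral banked structure for the WIF antecedent; closes no organ; `hsing` (singular set null) and CARTAN-FIN (existence of `S`) are hypotheses by shape here.
HC_CM is proved only modulo the 7 printed citations (2 remaining: hLiu418 = `stmt-HodgeConjecture-24832`, h413 = `stmt-HodgeConjecture-24833`) until rung 0 closes.

## References
* [Rogawski1990] J. D. Rogawski, *Automorphic Representations of Unitary Groups in Three Variables*, Ann. of Math. Stud. 123 (1990), §12.5 p. 182; §3.6 pp. 28–31.
* [HarishChandra1970] Harish-Chandra, *Harmonic analysis on reductive p-adic groups*, LNM 162 (1970), Lemma 42.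
-/

set_option autoImplicit false
-- the mandated namespace has the single-problem summit's repeated segment (`HodgeConjecture.HodgeConjecture`)
set_option linter.dupNamespace false

noncomputable section

open MeasureTheory Measure Set Filter Topology Function NumberField IsDedekindDomain Matrix Polynomial
open Literature.NumberTheory.Automorphic Literature.NumberTheory.Automorphic.UnitaryGroup Literature.NumberTheory.Rogawski1990
open Summit.HodgeConjecture.HodgeConjecture.Cruxes.H413.F0P3cStCharTSWeylCartanRadial
open scoped ENNReal NNReal MatrixGroups Pointwise

namespace Summit.HodgeConjecture.HodgeConjecture.Cruxes.H413.F0P3cStCharTSWeylCartanCover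

variable {L : Type} [Field L] [NumberField L] [IsCMField L] {v : HeightOneSpectrum (𝓞 ↥(maximalRealSubfield L))}

/-! ## §1 The `T`-regular set `G_T` of a subgroup `T`: regular, conjugation-invariant, depends only on the conjugacy class of `T` -/

/-- A regular element of `T` lies in `G_T` (`g = 1`). [cite: Rogawski1990, §12.5 p. 182] -/
theorem mem_cartanSet_of_mem {T : Subgroup (Gqs L v)} {t : Gqs L v} (ht : t ∈ T) (hreg : IsRegularElt (t.val : GL (Fin 3) (LocalRing L v))) :
    t ∈ {x | ∃ g t : Gqs L v, t ∈ T ∧ IsRegularElt (t.val : GL (Fin 3) (LocalRing L v)) ∧ g * t * g⁻¹ = x} :=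
  ⟨1, t, ht, hreg, by rw [one_mul, inv_one, mul_one]⟩

/-- Every element of `G_T` is regular. [cite: Rogawski1990, §12.5 p. 182; §3.1 p. 19] -/
theorem isRegularElt_of_mem_cartanSet {T : Subgroup (Gqs L v)} {x : Gqs L v}
    (hx : x ∈ {x | ∃ g t : Gqs L v, t ∈ T ∧ IsRegularElt (t.val : GL (Fin 3) (LocalRing L v)) ∧ g * t * g⁻¹ = x}) :
    IsRegularElt (x.val : GL (Fin 3) (LocalRing L v)) := by
  obtain ⟨g, t, -, ht, rfl⟩ := hx
  exact (isRegularElt_conj_val_iff L v g t).2 ht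

/-- `G_T` is conjugation-invariant. [cite: Rogawski1990, §12.5 p. 182] -/
theorem conj_mem_cartanSet {T : Subgroup (Gqs L v)} {x : Gqs L v} (y : Gqs L v)
    (hx : x ∈ {x | ∃ g t : Gqs L v, t ∈ T ∧ IsRegularElt (t.val : GL (Fin 3) (LocalRing L v)) ∧ g * t * g⁻¹ = x}) :
    y * x * y⁻¹ ∈ {x | ∃ g t : Gqs L v, t ∈ T ∧ IsRegularElt (t.val : GL (Fin 3) (LocalRing L v)) ∧ g * t * g⁻¹ = x} := by
  obtain ⟨g, t, htT, ht, rfl⟩ := hx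
  exact ⟨y * g, t, htT, ht, by group⟩

/-- **`G_T` depends only on the conjugacy class of `T`**: if `T′ = x T x⁻¹` (`∀ g, g ∈ T′ ↔ x⁻¹ g x ∈ T`, the tree's conjugacy idiom ★ `F0P3cStCharTSCartanReps`), then `G_{T′} = G_T`.
[cite: Rogawski1990, §12.5 p. 182] -/
theorem cartanSet_eq_of_forall_mem_iff {T T' : Subgroup (Gqs L v)} {x : Gqs L v} (h : ∀ g : Gqs L v, g ∈ T' ↔ x⁻¹ * g * x ∈ T) :
    {y | ∃ g t : Gqs L v, t ∈ T' ∧ IsRegularElt (t.val : GL (Fin 3) (LocalRing L v)) ∧ g * t * g⁻¹ = y} =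
      {y | ∃ g t : Gqs L v, t ∈ T ∧ IsRegularElt (t.val : GL (Fin 3) (LocalRing L v)) ∧ g * t * g⁻¹ = y} := by
  ext y
  constructor
  · rintro ⟨g, t, htT', ht, rfl⟩
    refine ⟨g * x, x⁻¹ * t * x, (h t).1 htT', ?_, by group⟩
    have e : x⁻¹ * t * x = x⁻¹ * t * x⁻¹⁻¹ := by rw [inv_inv]
    rw [e]; exact (isRegularElt_conj_val_iff L v x⁻¹ t).2 ht
  · rintro ⟨g, t, htT, ht, rfl⟩
    refine ⟨g * x⁻¹, x * t * x⁻¹, (h _).2 ?_, (isRegularElt_conj_val_iff L v x t).2 ht, by group⟩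
    have e : x⁻¹ * (x * t * x⁻¹) * x = t := by group
    rw [e]; exact htT

/-! ## §2 Cartan subgroups `T = Z(γ₀)`: `γ ∈ G_{Z(γ)}`; meeting `T`-regular sets force conjugate Cartans -/

/-- The centraliser of a conjugate: `g ∈ Z(x t x⁻¹) ↔ x⁻¹ g x ∈ Z(t)`. [cite: Rogawski1990, §3.1 p. 19] -/
theorem mem_centralizer_conj_iff (x t g : Gqs L v) :
    g ∈ Subgroup.centralizer ({x * t * x⁻¹} : Set (Gqs L v)) ↔ x⁻¹ * g * x ∈ Subgroup.centralizer ({t} : Set (Gqs L v)) := by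
  rw [Subgroup.mem_centralizer_singleton_iff, Subgroup.mem_centralizer_singleton_iff]
  constructor
  · intro h
    calc x⁻¹ * g * x * t = x⁻¹ * (g * (x * t * x⁻¹)) * x := by group
      _ = x⁻¹ * (x * t * x⁻¹ * g) * x := by rw [h]
      _ = t * (x⁻¹ * g * x) := by group
  · intro h
    calc g * (x * t * x⁻¹) = x * (x⁻¹ * g * x * t) * x⁻¹ := by group
      _ = x * (t * (x⁻¹ * g * x)) * x⁻¹ := by rw [h]
      _ = x * t * x⁻¹ * g := by group

/-- **A regular `γ` lies in `G_{Z(γ)}`.** [cite: Rogawski1990, §12.5 p. 182; §3.6 p. 28] -/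
theorem mem_cartanSet_centralizer_self {γ : Gqs L v} (hγ : IsRegularElt (γ.val : GL (Fin 3) (LocalRing L v))) :
    γ ∈ {x | ∃ g t : Gqs L v, t ∈ Subgroup.centralizer ({γ} : Set (Gqs L v)) ∧ IsRegularElt (t.val : GL (Fin 3) (LocalRing L v)) ∧ g * t * g⁻¹ = x} :=
  mem_cartanSet_of_mem (Subgroup.mem_centralizer_singleton_iff.2 rfl) hγ

/-- **A regular `γ` lies in `G_T` for every `T` conjugate to `Z(γ)`** (`∀ g, g ∈ Z(γ) ↔ x⁻¹ g x ∈ T` — the covering clause of ★ `exists_normalised_cartan_family`).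
[cite: Rogawski1990, §12.5 p. 182; §3.6 p. 28] -/
theorem mem_cartanSet_of_forall_mem_iff {γ : Gqs L v} (hγ : IsRegularElt (γ.val : GL (Fin 3) (LocalRing L v))) {T : Subgroup (Gqs L v)} {x : Gqs L v}
    (h : ∀ g : Gqs L v, g ∈ Subgroup.centralizer ({γ} : Set (Gqs L v)) ↔ x⁻¹ * g * x ∈ T) :
    γ ∈ {y | ∃ g t : Gqs L v, t ∈ T ∧ IsRegularElt (t.val : GL (Fin 3) (LocalRing L v)) ∧ g * t * g⁻¹ = y} := by
  rw [← cartanSet_eq_of_forall_mem_iff h]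
  exact mem_cartanSet_centralizer_self hγ

/-- **If `G_T` and `G_{T′}` MEET, for Cartan subgroups `T = Z(γ₀)`, `T′ = Z(γ₀′)`, then `T′` is conjugate to `T`**: a common element `g t g⁻¹ = g′ t′ g′⁻¹` (`t ∈ T`, `t′ ∈ T′` regular) has
`Z(t) = T`, `Z(t′) = T′` (★ p851692), so `T′ = y⁻¹ T y`-wise conjugate with `y = g⁻¹ g′`... stated in the tree's idiom: `∃ y, ∀ h, h ∈ T′ ↔ y⁻¹ h y ∈ T`.
[cite: Rogawski1990, §3.6 p. 28; §12.5 p. 182] -/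
theorem exists_forall_mem_iff_of_mem_cartanSet_of_mem_cartanSet {T T' : Subgroup (Gqs L v)} {γ₀ γ₀' : Gqs L v}
    (hγ₀ : IsRegularElt (γ₀.val : GL (Fin 3) (LocalRing L v))) (hT : T = Subgroup.centralizer ({γ₀} : Set (Gqs L v)))
    (hγ₀' : IsRegularElt (γ₀'.val : GL (Fin 3) (LocalRing L v))) (hT' : T' = Subgroup.centralizer ({γ₀'} : Set (Gqs L v))) {x : Gqs L v}
    (hx : x ∈ {y | ∃ g t : Gqs L v, t ∈ T ∧ IsRegularElt (t.val : GL (Fin 3) (LocalRing L v)) ∧ g * t * g⁻¹ = y})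
    (hx' : x ∈ {y | ∃ g t : Gqs L v, t ∈ T' ∧ IsRegularElt (t.val : GL (Fin 3) (LocalRing L v)) ∧ g * t * g⁻¹ = y}) :
    ∃ y : Gqs L v, ∀ h : Gqs L v, h ∈ T' ↔ y⁻¹ * h * y ∈ T := by
  obtain ⟨g, t, htT, ht, rfl⟩ := hx
  obtain ⟨g', t', ht'T', ht', heq⟩ := hx'
  -- `Z(t) = T`, `Z(t′) = T′`
  have hZt : Subgroup.centralizer ({t} : Set (Gqs L v)) = T := by
    rw [hT] at htT ⊢; exact centralizer_eq_of_mem_centralizer_of_isRegularElt L v hγ₀ htT ht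
  have hZt' : Subgroup.centralizer ({t'} : Set (Gqs L v)) = T' := by
    rw [hT'] at ht'T' ⊢; exact centralizer_eq_of_mem_centralizer_of_isRegularElt L v hγ₀' ht'T' ht'
  -- `t′ = (g′⁻¹ g) t (g′⁻¹ g)⁻¹`, so `Z(t′) = y Z(t) y⁻¹` with `y = g′⁻¹ g`
  have ht'eq : t' = (g'⁻¹ * g) * t * (g'⁻¹ * g)⁻¹ := by
    calc t' = g'⁻¹ * (g' * t' * g'⁻¹) * g' := by group
      _ = g'⁻¹ * (g * t * g⁻¹) * g' := by rw [heq]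
      _ = (g'⁻¹ * g) * t * (g'⁻¹ * g)⁻¹ := by group
  refine ⟨g'⁻¹ * g, fun h => ?_⟩
  rw [← hZt', ← hZt, ht'eq]
  exact mem_centralizer_conj_iff (g'⁻¹ * g) t h

/-- **Non-conjugate Cartan subgroups have DISJOINT `T`-regular sets.** [cite: Rogawski1990, §12.5 p. 182; §3.6 p. 28] -/
theorem disjoint_cartanSet_of_not_conj {T T' : Subgroup (Gqs L v)} {γ₀ γ₀' : Gqs L v}
    (hγ₀ : IsRegularElt (γ₀.val : GL (Fin 3) (LocalRing L v))) (hT : T = Subgroup.centralizer ({γ₀} : Set (Gqs L v)))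
    (hγ₀' : IsRegularElt (γ₀'.val : GL (Fin 3) (LocalRing L v))) (hT' : T' = Subgroup.centralizer ({γ₀'} : Set (Gqs L v)))
    (hnc : ∀ y : Gqs L v, ¬ ∀ h : Gqs L v, h ∈ T' ↔ y⁻¹ * h * y ∈ T) :
    Disjoint {y | ∃ g t : Gqs L v, t ∈ T ∧ IsRegularElt (t.val : GL (Fin 3) (LocalRing L v)) ∧ g * t * g⁻¹ = y}
      {y | ∃ g t : Gqs L v, t ∈ T' ∧ IsRegularElt (t.val : GL (Fin 3) (LocalRing L v)) ∧ g * t * g⁻¹ = y} := by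
  rw [Set.disjoint_left]
  intro x hx hx'
  obtain ⟨y, hy⟩ := exists_forall_mem_iff_of_mem_cartanSet_of_mem_cartanSet hγ₀ hT hγ₀' hT' hx hx'
  exact hnc y hy

/-! ## §3 A system of representatives of the Cartan classes: the `G_T` cover the regular set, disjointly; the outer sum of the Weyl integration formula -/

/-- **THE `T`-REGULAR SETS OF A COVERING FAMILY EXHAUST THE REGULAR SET**: if every `Z(γ)` (`γ` regular) is conjugate to a member of `S`, then `⋃_{T ∈ S} G_T = {g | g regular}`.
[cite: Rogawski1990, §12.5 p. 182; §3.6 pp. 28–31] -/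
theorem biUnion_cartanSet_eq_setOf_isRegularElt (S : Finset (Subgroup (Gqs L v)))
    (hcov : ∀ γ : Gqs L v, IsRegularElt (γ.val : GL (Fin 3) (LocalRing L v)) →
      ∃ T ∈ S, ∃ x : Gqs L v, ∀ g : Gqs L v, g ∈ Subgroup.centralizer ({γ} : Set (Gqs L v)) ↔ x⁻¹ * g * x ∈ T) :
    (⋃ T ∈ S, {y | ∃ g t : Gqs L v, t ∈ T ∧ IsRegularElt (t.val : GL (Fin 3) (LocalRing L v)) ∧ g * t * g⁻¹ = y}) =
      {g : Gqs L v | IsRegularElt (g.val : GL (Fin 3) (LocalRing L v))} := by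
  ext y
  simp only [Set.mem_iUnion, exists_prop]
  constructor
  · rintro ⟨T, -, hy⟩
    exact isRegularElt_of_mem_cartanSet hy
  · intro hy
    obtain ⟨T, hTS, x, hx⟩ := hcov y hy
    exact ⟨T, hTS, mem_cartanSet_of_forall_mem_iff hy hx⟩

/-- **THE OUTER SUM OF THE WEYL INTEGRATION FORMULA, ON THE REGULAR SET**: for a finite family `S` of Cartan subgroups `T = Z(γ_T)` of `U(Φ₃)(L⁺_v)` (`v` non-split), pairwise
non-conjugate and meeting every conjugacy class of Cartan subgroups, and any measure `ν` on `G`, `∫⁻_{G^{reg}} f dν = Σ_{T ∈ S} ∫⁻_{G_T} f dν` for every `f : G → ℝ≥0∞` (the `G_T` are Borel,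
★ p851692, pairwise disjoint, §2, and cover `G^{reg}`, above). [cite: Rogawski1990, §12.5 p. 182] [cite: HarishChandra1970, Lemma 42] -/
theorem lintegral_setOf_isRegularElt_eq_sum_cartanSet (hns : ∀ w : PlacesOver L v, IsCMField.complexConj L • w.1 = w.1)
    [MeasurableSpace (Gqs L v)] [BorelSpace (Gqs L v)] [LocallyCompactSpace (Gqs L v)] [SecondCountableTopology (Gqs L v)] [T2Space (Gqs L v)]
    (S : Finset (Subgroup (Gqs L v)))
    (hS : ∀ T ∈ S, ∃ γ : Gqs L v, IsRegularElt (γ.val : GL (Fin 3) (LocalRing L v)) ∧ T = Subgroup.centralizer ({γ} : Set (Gqs L v)))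
    (hcov : ∀ γ : Gqs L v, IsRegularElt (γ.val : GL (Fin 3) (LocalRing L v)) →
      ∃ T ∈ S, ∃ x : Gqs L v, ∀ g : Gqs L v, g ∈ Subgroup.centralizer ({γ} : Set (Gqs L v)) ↔ x⁻¹ * g * x ∈ T)
    (hnc : ∀ T ∈ S, ∀ T' ∈ S, T ≠ T' → ∀ y : Gqs L v, ¬ ∀ h : Gqs L v, h ∈ T' ↔ y⁻¹ * h * y ∈ T)
    (ν : Measure (Gqs L v)) (f : Gqs L v → ℝ≥0∞) :
    ∫⁻ y in {g : Gqs L v | IsRegularElt (g.val : GL (Fin 3) (LocalRing L v))}, f y ∂ν =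
      ∑ T ∈ S, ∫⁻ y in {y | ∃ g t : Gqs L v, t ∈ T ∧ IsRegularElt (t.val : GL (Fin 3) (LocalRing L v)) ∧ g * t * g⁻¹ = y}, f y ∂ν := by
  classical
  rw [← biUnion_cartanSet_eq_setOf_isRegularElt S hcov]
  refine lintegral_biUnion_finset ?_ (fun T hT => ?_) f
  · intro T hT T' hT' hne
    obtain ⟨γ, hγ, hTγ⟩ := hS T hT
    obtain ⟨γ', hγ', hT'γ'⟩ := hS T' hT'
    exact disjoint_cartanSet_of_not_conj hγ hTγ hγ' hT'γ' (hnc T hT T' hT' hne)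
  · obtain ⟨γ, hγ, hTγ⟩ := hS T hT
    letI : MeasurableSpace (Gqs L v ⧸ T) := borel _
    haveI : BorelSpace (Gqs L v ⧸ T) := ⟨rfl⟩
    have hTa : ∀ a ∈ T, ∀ b ∈ T, a * b = b * a := mul_comm_cartan hγ hTγ
    obtain ⟨Φ, hΦ⟩ := F0P3cStCharTSWeylHypMeasure.exists_conjFamily T hTa
    exact measurableSet_cartanSet hγ hTγ Φ hΦ hns

/-- **THE OUTER SUM OF THE WEYL INTEGRATION FORMULA**: as above, and IF the singular (non-regular) set is `ν`-null (`hsing`; print: «the set of regular elements … its complement has measure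
zero», [HarishChandra1970 L. 42]) then `∫⁻_G f dν = Σ_{T ∈ S} ∫⁻_{G_T} f dν`. [cite: Rogawski1990, §12.5 p. 182] [cite: HarishChandra1970, Lemma 42] -/
theorem lintegral_eq_sum_cartanSet_of_null (hns : ∀ w : PlacesOver L v, IsCMField.complexConj L • w.1 = w.1)
    [MeasurableSpace (Gqs L v)] [BorelSpace (Gqs L v)] [LocallyCompactSpace (Gqs L v)] [SecondCountableTopology (Gqs L v)] [T2Space (Gqs L v)]
    (S : Finset (Subgroup (Gqs L v)))
    (hS : ∀ T ∈ S, ∃ γ : Gqs L v, IsRegularElt (γ.val : GL (Fin 3) (LocalRing L v)) ∧ T = Subgroup.centralizer ({γ} : Set (Gqs L v)))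
    (hcov : ∀ γ : Gqs L v, IsRegularElt (γ.val : GL (Fin 3) (LocalRing L v)) →
      ∃ T ∈ S, ∃ x : Gqs L v, ∀ g : Gqs L v, g ∈ Subgroup.centralizer ({γ} : Set (Gqs L v)) ↔ x⁻¹ * g * x ∈ T)
    (hnc : ∀ T ∈ S, ∀ T' ∈ S, T ≠ T' → ∀ y : Gqs L v, ¬ ∀ h : Gqs L v, h ∈ T' ↔ y⁻¹ * h * y ∈ T)
    (ν : Measure (Gqs L v)) (hsing : ν {g : Gqs L v | ¬ IsRegularElt (g.val : GL (Fin 3) (LocalRing L v))} = 0) (f : Gqs L v → ℝ≥0∞) :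
    ∫⁻ y, f y ∂ν = ∑ T ∈ S, ∫⁻ y in {y | ∃ g t : Gqs L v, t ∈ T ∧ IsRegularElt (t.val : GL (Fin 3) (LocalRing L v)) ∧ g * t * g⁻¹ = y}, f y ∂ν := by
  have hae : ∀ᵐ y ∂ν, y ∈ {g : Gqs L v | IsRegularElt (g.val : GL (Fin 3) (LocalRing L v))} := by
    rw [ae_iff]; exact hsing
  rw [← lintegral_setOf_isRegularElt_eq_sum_cartanSet hns S hS hcov hnc ν f, Measure.restrict_eq_self_of_ae_mem hae]

end Summit.HodgeConjecture.HodgeConjecture.Cruxes.H413.F0P3cStCharTSWeylCartanCover
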